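import Mathlib

/-!
# `HyperbolicEnd` (stmt-SmoothPoincare4-7825), line `Sketch`, negative side — smoothness of `ψ_M`

Helper for the native frozen refutation of `stub_certificateFill` on `ℝ⁴ = EuclideanSpace ℝ (Fin 4)`
(stub helper_frozen_psiContDiff, registered on the crux item).

With `q₁ x = x 0 ^ 2 + x 1 ^ 2`, `q₂ x = x 2 ^ 2 + x 3 ^ 2` and the cutoff
`χ t = Real.smoothTransition ((81/100 - t) * (25/14))`, the potential
`ψ_M x = -8 χ (q₂ x) log (q₁ x + 1/1000) + M q₂ x + (q₁ x + q₂ x)` is `C^∞` on all of `ℝ⁴`: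
the coordinates are continuous linear (`contDiff_piLp_apply`), `Real.smoothTransition` is smooth
(`Real.smoothTransition.contDiff`) and `log` is smooth away from `0` (`ContDiff.log`), the argument
`q₁ x + 1/1000` being positive.
-/

noncomputable section

-- the prescribed namespace `Summit.<P>.<Sub>.…` duplicates `SmoothPoincare4` (P = Sub)
set_option linter.dupNamespace false

open scoped ContDiff Topology Real
open Laplacian Set Filter Metric Complex

namespace Summit.SmoothPoincare4.SmoothPoincare4.Theorems.HyperbolicEnd.Negative

/-- helper (T5a): the potential
`ψ_M x = -8 χ(q₂ x) log(q₁ x + 10⁻³) + M q₂ x + (q₁ x + q₂ x)` is smooth on `ℝ⁴`. -/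
theorem helper_frozen_psiContDiff : ∀ (M : ℝ), ContDiff ℝ ∞ (fun x : EuclideanSpace ℝ (Fin 4) => -8 * Real.smoothTransition ((81 / 100 - (x 2 ^ 2 + x 3 ^ 2)) * (25 / 14)) * Real.log (x 0 ^ 2 + x 1 ^ 2 + 1 / 1000) + M * (x 2 ^ 2 + x 3 ^ 2) + (x 0 ^ 2 + x 1 ^ 2 + x 2 ^ 2 + x 3 ^ 2)) := by
  intro M
  have hc : ∀ i : Fin 4, ContDiff ℝ ∞ (fun x : EuclideanSpace ℝ (Fin 4) => x i) := fun i =>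
    contDiff_piLp_apply (p := 2)
  have hlog : ContDiff ℝ ∞
      (fun x : EuclideanSpace ℝ (Fin 4) => Real.log (x 0 ^ 2 + x 1 ^ 2 + 1 / 1000)) := by
    refine ContDiff.log ?_ fun x => ?_
    · exact (((hc 0).pow 2).add ((hc 1).pow 2)).add contDiff_const
    · positivity
  have hχ : ContDiff ℝ ∞ (fun x : EuclideanSpace ℝ (Fin 4) =>
      Real.smoothTransition ((81 / 100 - (x 2 ^ 2 + x 3 ^ 2)) * (25 / 14))) :=
    Real.smoothTransition.contDiff.comp
      ((contDiff_const.sub (((hc 2).pow 2).add ((hc 3).pow 2))).mul contDiff_const)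
  exact (((contDiff_const.mul hχ).mul hlog).add (contDiff_const.mul
    (((hc 2).pow 2).add ((hc 3).pow 2)))).add
    (((((hc 0).pow 2).add ((hc 1).pow 2)).add ((hc 2).pow 2)).add ((hc 3).pow 2))

end Summit.SmoothPoincare4.SmoothPoincare4.Theorems.HyperbolicEnd.Negative

end
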